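import Mathlib
import HarnessLib
import Summits.Ventures.LatticeQCDFlow.Exactness.LatticeCoordAvgBessel
import Summits.Ventures.LatticeQCDFlow.Exactness.SphereLOFlowEntropyFloorVariance

/-!
# The extensive floor in terms of conditional variances of the static block term given disjoint groups of spins: `Var(A_C h_j) ≥ (c⁴/8)·Σ_i Var(E[V_j | ω_{P_i}]) − 4ρ_j²`

HONEST FRAMING: exact (Metropolis-corrected) sampling algorithms for lattice gauge theory;
figures of merit are autocorrelation/cost numbers at stated couplings and volumes; no
continuum-physics claim.

Venture `LatticeQCDFlow` (cell pub-lqcd), topic `Exactness`; FANOUT row 7 (`s0-cpn-null`).  NEW WORK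
of the cell over this lineage's `Exactness/LatticeCoordAvgBessel.lean` (Hoeffding–Bessel:
`Σ_i Var(A_{univ∖P_i} G) ≤ Var(G)` for disjoint `P_i`; `A_s∘A_t = A_{t∪s}`),
`Exactness/SphereLOFlowEntropyFloorVariance.lean` (the variance form of the one-block floor, smallness
`M_j` of the localized block action), `Exactness/SphereLOFlowEntropyFloorGerm.lean` (the static germ
`|g_n + (c²/2)v_n| ≤ (4|κ|³υ³/(d−1)²)c³`, `|A_s G| ≤ ρ` if `|G| ≤ ρ`) and
`Exactness/CenteredExponentialMomentVarianceFloor.lean`; nothing is cited as a fact.  The point: the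
variance of the corridor-averaged localized block action — the quantity the variance form of the floor
runs on — is bounded BELOW by `(c⁴/8)` times the variance of the corridor average of the STATIC block
term minus `4ρ_j²` (no square roots: `((c²/2)Q)² ≤ 2P² + 2(2ρ_j)²` pointwise), and the latter variance
is at least the SUM over any family of pairwise disjoint groups of sites `P_i` off the corridors of
`Var(E[V_j | ω_{P_i}])` (Bessel + `A_{univ∖P_i}∘A_C = A_{univ∖P_i}`) — for the lattice CP(N−1)/O(N)
action with two-site groups `{k, l}` these are explicit two-spin integrals, flow-free and volume-free.

## Content

* §1 **`variance_coordAvg_static_le`** — `(c⁴/4)·Var(A_C V) ≤ 2·Var(A_C h) + 8ρ²` for any finite index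
  set `I` (`h = Σ_I g_n`, `V = Σ_I v_n`, `ρ = |I|(4|κ|³υ³/(d−1)²)c³`);
  **`sum_variance_condExp_le_variance_coordAvg`** — `Σ_i Var(A_{univ∖P_i} V) ≤ Var(A_C V)` for pairwise
  disjoint `P_i` disjoint from `C`.
* §2 **`log_one_add_pairs_div_le_blockTerm`** — one block:
  `log(1 + (max 0 ((c⁴/8)Σ_i Var(A_{univ∖P_i} V) − 4ρ²))/(2 + M)) ≤ ∫h dπ̄ + log∫e^{−A_C h} dπ̄`,
  `M = 2|I|(κ²υ²/(d−1))c²`; **`sum_log_one_add_pairs_sub_le_klDiv_map_loFlow`** — THE EXTENSIVE FLOOR in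
  terms of conditional variances of the static block terms given disjoint groups of spins.

NOT CLAIMED: the evaluation of any two-site conditional variance for specific couplings; numbers.
-/

noncomputable section

namespace Summit.Ventures.LatticeQCDFlow.Exactness

open Function Set Metric MeasureTheory NormedSpace InnerProductSpace InformationTheory
open scoped RealInnerProductSpace Topology Nat Classical

variable {Λ : Type*} {E : Type*} [NormedAddCommGroup E] [InnerProductSpace ℝ E]
  [FiniteDimensional ℝ E] [Fintype Λ] [DecidableEq Λ]

section Pairs

variable [MeasurableSpace E] [BorelSpace E] [Nontrivial E] {U : Λ → Λ → (E →L[ℝ] E)} {T : ℝ}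

set_option maxHeartbeats 400000 in
/-- **`(c⁴/4)·Var(A_C V) ≤ 2·Var(A_C h) + 8ρ²`**: the variance of the corridor average of the STATIC
block term `V = Σ_{n∈I} v_n` is controlled by that of the localized block action `h = Σ_{n∈I} g_n`
(`0 ≤ c ≤ |T| + 1`, `ρ = |I|(4|κ|³υ³/(d−1)²)c³`; pointwise `(c²/2)(A_C V − ∫V) = D − (A_C h − ∫h)` with
`|D| ≤ 2ρ`, then `(a − b)² ≤ 2a² + 2b²`). -/
theorem variance_coordAvg_static_le (hU0 : ∀ n, U n n = 0)
    (hUadj : ∀ m n (v w : E), ⟪U m n v, w⟫ = ⟪v, U n m w⟫) (hd : 2 ≤ Module.finrank ℝ E)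
    (κ S₀ : ℝ) {υ : ℝ} (hυ : ∀ k, ∑ m, ‖U k m‖ ≤ υ) {e : Λ → E} (he : ∀ n, ‖e n‖ = 1) (m : ℕ)
    {c : ℝ} (hc0 : 0 ≤ c) (hc : c ≤ |T| + 1)
    {g : Λ → (Λ → sphere (0 : E) 1) → ℝ}
    (hg : ∀ n ω, g n ω = -∫ u in (0 : ℝ)..c, u * (2 * κ ^ 2 / ((Module.finrank ℝ E : ℝ) - 1) *
      ‖tangentKick (localField U n (sphereTDFlow (G := fun _ : ℝ => loFlowAction κ S₀ U)
          (contDiff_const_family (contDiff_loFlowAction U κ S₀)) T 0 u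
          ((nball (fun k => insert k (couplingNbhd U k)) (m + 1) n).piecewise
            (fun i => ((ω i : sphere (0 : E) 1) : E)) e)))
        (sphereTDFlow (G := fun _ : ℝ => loFlowAction κ S₀ U)
          (contDiff_const_family (contDiff_loFlowAction U κ S₀)) T 0 u
          ((nball (fun k => insert k (couplingNbhd U k)) (m + 1) n).piecewise
            (fun i => ((ω i : sphere (0 : E) 1) : E)) e) n)‖ ^ 2))
    (I C : Finset Λ) :
    c ^ 4 / 4 * ∫ ω, (coordAvg (uniformSphere (volume : Measure E)) C (fun ω => ∑ n ∈ I,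
          2 * κ ^ 2 / ((Module.finrank ℝ E : ℝ) - 1) *
            ‖tangentKick (localField U n (fun i => ((ω i : sphere (0 : E) 1) : E))) (ω n : E)‖ ^ 2) ω -
          ∫ ω', (∑ n ∈ I, 2 * κ ^ 2 / ((Module.finrank ℝ E : ℝ) - 1) *
            ‖tangentKick (localField U n (fun i => ((ω' i : sphere (0 : E) 1) : E))) (ω' n : E)‖ ^ 2)
            ∂Measure.pi (fun _ : Λ => uniformSphere (volume : Measure E))) ^ 2
          ∂Measure.pi (fun _ : Λ => uniformSphere (volume : Measure E)) ≤
      2 * ∫ ω, (coordAvg (uniformSphere (volume : Measure E)) C (fun ω => ∑ n ∈ I, g n ω) ω -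
          ∫ ω', (∑ n ∈ I, g n ω') ∂Measure.pi (fun _ : Λ => uniformSphere (volume : Measure E))) ^ 2
          ∂Measure.pi (fun _ : Λ => uniformSphere (volume : Measure E)) +
        8 * (I.card * (4 * |κ| ^ 3 * υ ^ 3 / ((Module.finrank ℝ E : ℝ) - 1) ^ 2 * c ^ 3)) ^ 2 := by
  set μ : Measure (Λ → sphere (0 : E) 1) := Measure.pi (fun _ : Λ => uniformSphere (volume : Measure E))
    with hμ
  set v : Λ → (Λ → sphere (0 : E) 1) → ℝ := fun n ω => 2 * κ ^ 2 / ((Module.finrank ℝ E : ℝ) - 1) *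
    ‖tangentKick (localField U n (fun i => ((ω i : sphere (0 : E) 1) : E))) (ω n : E)‖ ^ 2 with hv
  set V : (Λ → sphere (0 : E) 1) → ℝ := fun ω => ∑ n ∈ I, v n ω with hV
  set h : (Λ → sphere (0 : E) 1) → ℝ := fun ω => ∑ n ∈ I, g n ω with hh
  set ρ : ℝ := I.card * (4 * |κ| ^ 3 * υ ^ 3 / ((Module.finrank ℝ E : ℝ) - 1) ^ 2 * c ^ 3) with hρ
  have hgc : ∀ n, Continuous (g n) := continuous_loLocalTerm (U := U) κ S₀ e m c hg (T := T)
  have hvc : ∀ n, Continuous (v n) := fun n => (continuous_loCarreSite (U := U) κ n).comp continuous_sphereConfig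
  have hhc : Continuous h := continuous_finsetSum _ fun n _ => hgc n
  have hVc : Continuous V := continuous_finsetSum _ fun n _ => hvc n
  -- the summed germ `|h + (c²/2)V| ≤ ρ`
  have hgerm : ∀ ω, |h ω + c ^ 2 / 2 * V ω| ≤ ρ := by
    intro ω
    have e1 : h ω + c ^ 2 / 2 * V ω = ∑ n ∈ I, (g n ω + c ^ 2 / 2 * v n ω) := by
      simp only [hh, hV, Finset.mul_sum, Finset.sum_add_distrib]
    rw [e1]
    refine (Finset.abs_sum_le_sum_abs _ _).trans ?_
    calc ∑ n ∈ I, |g n ω + c ^ 2 / 2 * v n ω|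
        ≤ ∑ _n ∈ I, 4 * |κ| ^ 3 * υ ^ 3 / ((Module.finrank ℝ E : ℝ) - 1) ^ 2 * c ^ 3 :=
          Finset.sum_le_sum fun n _ =>
            abs_loLocalTerm_add_germ_le hU0 hUadj hd κ S₀ hυ he m hc0 hc hg n ω (T := T)
      _ = ρ := by rw [Finset.sum_const, nsmul_eq_mul]
  set Dfun : (Λ → sphere (0 : E) 1) → ℝ := fun ω => h ω + c ^ 2 / 2 * V ω with hD
  have hcV : Continuous (fun ω : Λ → sphere (0 : E) 1 => c ^ 2 / 2 * V ω) := continuous_const.mul hVc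
  have hDc : Continuous Dfun := hhc.add hcV
  have hAD : ∀ ω, |coordAvg (uniformSphere (volume : Measure E)) C Dfun ω| ≤ ρ :=
    fun ω => abs_coordAvg_le_of_abs_le _ C hgerm ω
  have hmD : |∫ ω, Dfun ω ∂μ| ≤ ρ := by
    have hm := norm_integral_le_of_norm_le_const (μ := μ) (f := Dfun) (C := ρ)
      (ae_of_all _ fun ω => by rw [Real.norm_eq_abs]; exact hgerm ω)
    rwa [hμ, probReal_univ, mul_one, Real.norm_eq_abs, ← hμ] at hm
  have hAlin : ∀ ω, coordAvg (uniformSphere (volume : Measure E)) C Dfun ω =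
      coordAvg (uniformSphere (volume : Measure E)) C h ω +
        c ^ 2 / 2 * coordAvg (uniformSphere (volume : Measure E)) C V ω := by
    intro ω
    rw [hD, coordAvg_add _ C hhc hcV]
    have hm : coordAvg (uniformSphere (volume : Measure E)) C (fun ω => c ^ 2 / 2 * V ω) ω =
        c ^ 2 / 2 * coordAvg (uniformSphere (volume : Measure E)) C V ω :=
      coordAvg_mul_left _ C (Φ := fun _ => c ^ 2 / 2) (H := V) (fun _ _ => rfl) ω
    rw [hm]
  have hmlin : ∫ ω, Dfun ω ∂μ = (∫ ω, h ω ∂μ) + c ^ 2 / 2 * ∫ ω, V ω ∂μ := by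
    have hi1 : Integrable h μ := integrable_pi_of_continuous _ hhc
    have hi2 : Integrable (fun ω => c ^ 2 / 2 * V ω) μ := (integrable_pi_of_continuous _ hVc).const_mul _
    rw [hD, integral_add hi1 hi2, integral_const_mul]
  -- pointwise `((c²/2)Q)² ≤ 2P² + 2(2ρ)²`
  have hpt : ∀ ω, c ^ 4 / 4 * (coordAvg (uniformSphere (volume : Measure E)) C V ω - ∫ ω', V ω' ∂μ) ^ 2 ≤
      2 * (coordAvg (uniformSphere (volume : Measure E)) C h ω - ∫ ω', h ω' ∂μ) ^ 2 + 8 * ρ ^ 2 := by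
    intro ω
    have key : c ^ 2 / 2 * (coordAvg (uniformSphere (volume : Measure E)) C V ω - ∫ ω', V ω' ∂μ) =
        (coordAvg (uniformSphere (volume : Measure E)) C Dfun ω - ∫ ω', Dfun ω' ∂μ) -
          (coordAvg (uniformSphere (volume : Measure E)) C h ω - ∫ ω', h ω' ∂μ) := by
      rw [hAlin ω, hmlin]; ring
    have hDb : |coordAvg (uniformSphere (volume : Measure E)) C Dfun ω - ∫ ω', Dfun ω' ∂μ| ≤ 2 * ρ := by
      have := (abs_sub _ _).trans (add_le_add (hAD ω) hmD); linarith
    have hsq : (coordAvg (uniformSphere (volume : Measure E)) C Dfun ω - ∫ ω', Dfun ω' ∂μ) ^ 2 ≤ (2 * ρ) ^ 2 := by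
      have h0 : 0 ≤ 2 * ρ := le_trans (abs_nonneg _) hDb
      nlinarith [abs_le.1 hDb, sq_abs (coordAvg (uniformSphere (volume : Measure E)) C Dfun ω - ∫ ω', Dfun ω' ∂μ)]
    have e2 : c ^ 4 / 4 * (coordAvg (uniformSphere (volume : Measure E)) C V ω - ∫ ω', V ω' ∂μ) ^ 2 =
        (c ^ 2 / 2 * (coordAvg (uniformSphere (volume : Measure E)) C V ω - ∫ ω', V ω' ∂μ)) ^ 2 := by ring
    rw [e2, key]
    nlinarith [sq_nonneg ((coordAvg (uniformSphere (volume : Measure E)) C Dfun ω - ∫ ω', Dfun ω' ∂μ) +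
      (coordAvg (uniformSphere (volume : Measure E)) C h ω - ∫ ω', h ω' ∂μ))]
  -- integrate
  have hQc : Continuous fun ω => (coordAvg (uniformSphere (volume : Measure E)) C V ω - ∫ ω', V ω' ∂μ) ^ 2 :=
    ((continuous_coordAvg _ C hVc).sub continuous_const).pow 2
  have hPc : Continuous fun ω => (coordAvg (uniformSphere (volume : Measure E)) C h ω - ∫ ω', h ω' ∂μ) ^ 2 :=
    ((continuous_coordAvg _ C hhc).sub continuous_const).pow 2
  have hLi : Integrable (fun ω => c ^ 4 / 4 *
      (coordAvg (uniformSphere (volume : Measure E)) C V ω - ∫ ω', V ω' ∂μ) ^ 2) μ :=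
    (integrable_pi_of_continuous _ hQc).const_mul _
  have hP2 : Integrable (fun ω => 2 *
      (coordAvg (uniformSphere (volume : Measure E)) C h ω - ∫ ω', h ω' ∂μ) ^ 2) μ :=
    (integrable_pi_of_continuous _ hPc).const_mul _
  have hRi : Integrable (fun ω => 2 *
      (coordAvg (uniformSphere (volume : Measure E)) C h ω - ∫ ω', h ω' ∂μ) ^ 2 + 8 * ρ ^ 2) μ :=
    hP2.add (integrable_const _)
  have hmono := integral_mono hLi hRi hpt
  have h8 : Integrable (fun _ : Λ → sphere (0 : E) 1 => 8 * ρ ^ 2) μ := integrable_const _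
  rw [integral_const_mul, integral_add hP2 h8, integral_const_mul, integral_const, smul_eq_mul, hμ,
    probReal_univ, one_mul, ← hμ] at hmono
  simpa only [hV, hh, hv, hρ] using hmono

/-- **`Σ_i Var(E[V | ω_{P_i}]) ≤ Var(A_C V)`** for pairwise disjoint groups of sites `P_i` disjoint from the
corridor set `C`, and any continuous `V` (Bessel applied to `A_C V`, and `A_{univ∖P_i}(A_C V) = A_{univ∖P_i} V`
since `C ⊆ univ ∖ P_i`). -/
theorem sum_variance_condExp_le_variance_coordAvg {J : Type*} (Tp : Finset J) (P : J → Finset Λ)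
    (hP : ∀ i ∈ Tp, ∀ i' ∈ Tp, i ≠ i' → Disjoint (P i) (P i')) (C : Finset Λ)
    (hPC : ∀ i ∈ Tp, Disjoint (P i) C) {V : (Λ → sphere (0 : E) 1) → ℝ} (hV : Continuous V) :
    ∑ i ∈ Tp, ∫ ω, (coordAvg (uniformSphere (volume : Measure E)) (Finset.univ \ P i) V ω -
        ∫ ω', V ω' ∂Measure.pi (fun _ : Λ => uniformSphere (volume : Measure E))) ^ 2
        ∂Measure.pi (fun _ : Λ => uniformSphere (volume : Measure E)) ≤
      ∫ ω, (coordAvg (uniformSphere (volume : Measure E)) C V ω -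
        ∫ ω', V ω' ∂Measure.pi (fun _ : Λ => uniformSphere (volume : Measure E))) ^ 2
        ∂Measure.pi (fun _ : Λ => uniformSphere (volume : Measure E)) := by
  set μ1 := uniformSphere (volume : Measure E) with hμ1
  have hAc : Continuous (coordAvg μ1 C V) := continuous_coordAvg _ C hV
  have hB := sum_variance_condExp_le_variance μ1 Tp P hP hAc
  have hmean : ∫ ω, coordAvg μ1 C V ω ∂Measure.pi (fun _ : Λ => μ1) = ∫ ω, V ω ∂Measure.pi (fun _ : Λ => μ1) :=
    integral_coordAvg _ C hV
  rw [hmean] at hB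
  refine le_trans (le_of_eq (Finset.sum_congr rfl fun i hi => ?_)) hB
  have hunion : C ∪ (Finset.univ \ P i) = Finset.univ \ P i := by
    ext k
    simp only [Finset.mem_union, Finset.mem_sdiff, Finset.mem_univ, true_and]
    constructor
    · rintro (hk | hk)
      · exact fun hkP => Finset.disjoint_left.1 (hPC i hi) hkP hk
      · exact hk
    · exact fun hk => Or.inr hk
  refine integral_congr_ae (ae_of_all _ fun ω => ?_)
  simp only
  rw [coordAvg_coordAvg_eq_union μ1 (Finset.univ \ P i) C hV ω, hunion]

set_option maxHeartbeats 400000 in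
/-- **ONE BLOCK, IN TERMS OF CONDITIONAL VARIANCES OF THE STATIC BLOCK TERM.**  For a finite index set
`I` (`h = Σ_I g_n`, `V = Σ_I v_n`, `ρ = |I|(4|κ|³υ³/(d−1)²)c³`, `M = 2|I|(κ²υ²/(d−1))c²`), a corridor set
`C`, and pairwise disjoint groups of sites `P_i` (`i ∈ T_P`) disjoint from `C` (`0 ≤ c ≤ |T| + 1`):
`log(1 + (max 0 ((c⁴/8)·Σ_i Var(A_{univ∖P_i} V) − 4ρ²))/(2 + M)) ≤ ∫h dπ̄ + log ∫e^{−A_C h} dπ̄` —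
the block term of the entropy floor is bounded below by the conditional variances of the STATIC block
term given disjoint groups of spins (for two-site groups: explicit two-spin integrals). -/
theorem log_one_add_pairs_div_le_blockTerm (hU0 : ∀ n, U n n = 0)
    (hUadj : ∀ m n (v w : E), ⟪U m n v, w⟫ = ⟪v, U n m w⟫) (hd : 2 ≤ Module.finrank ℝ E)
    (κ S₀ : ℝ) {υ : ℝ} (hυ : ∀ k, ∑ m, ‖U k m‖ ≤ υ) {e : Λ → E} (he : ∀ n, ‖e n‖ = 1) (m : ℕ)
    {c : ℝ} (hc0 : 0 ≤ c) (hc : c ≤ |T| + 1)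
    {g : Λ → (Λ → sphere (0 : E) 1) → ℝ}
    (hg : ∀ n ω, g n ω = -∫ u in (0 : ℝ)..c, u * (2 * κ ^ 2 / ((Module.finrank ℝ E : ℝ) - 1) *
      ‖tangentKick (localField U n (sphereTDFlow (G := fun _ : ℝ => loFlowAction κ S₀ U)
          (contDiff_const_family (contDiff_loFlowAction U κ S₀)) T 0 u
          ((nball (fun k => insert k (couplingNbhd U k)) (m + 1) n).piecewise
            (fun i => ((ω i : sphere (0 : E) 1) : E)) e)))
        (sphereTDFlow (G := fun _ : ℝ => loFlowAction κ S₀ U)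
          (contDiff_const_family (contDiff_loFlowAction U κ S₀)) T 0 u
          ((nball (fun k => insert k (couplingNbhd U k)) (m + 1) n).piecewise
            (fun i => ((ω i : sphere (0 : E) 1) : E)) e) n)‖ ^ 2))
    (I C : Finset Λ) {J' : Type*} (Tp : Finset J') (P : J' → Finset Λ)
    (hP : ∀ i ∈ Tp, ∀ i' ∈ Tp, i ≠ i' → Disjoint (P i) (P i')) (hPC : ∀ i ∈ Tp, Disjoint (P i) C) :
    Real.log (1 + (max 0 (c ^ 4 / 8 * ∑ i ∈ Tp, ∫ ω,
          (coordAvg (uniformSphere (volume : Measure E)) (Finset.univ \ P i) (fun ω => ∑ n ∈ I,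
            2 * κ ^ 2 / ((Module.finrank ℝ E : ℝ) - 1) *
              ‖tangentKick (localField U n (fun i => ((ω i : sphere (0 : E) 1) : E))) (ω n : E)‖ ^ 2) ω -
          ∫ ω', (∑ n ∈ I, 2 * κ ^ 2 / ((Module.finrank ℝ E : ℝ) - 1) *
            ‖tangentKick (localField U n (fun i => ((ω' i : sphere (0 : E) 1) : E))) (ω' n : E)‖ ^ 2)
            ∂Measure.pi (fun _ : Λ => uniformSphere (volume : Measure E))) ^ 2
          ∂Measure.pi (fun _ : Λ => uniformSphere (volume : Measure E)) -
        4 * (I.card * (4 * |κ| ^ 3 * υ ^ 3 / ((Module.finrank ℝ E : ℝ) - 1) ^ 2 * c ^ 3)) ^ 2)) /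
        (2 + 2 * (I.card * (κ ^ 2 * υ ^ 2 / ((Module.finrank ℝ E : ℝ) - 1) * c ^ 2)))) ≤
      (∫ ω, (∑ n ∈ I, g n ω) ∂Measure.pi (fun _ : Λ => uniformSphere (volume : Measure E))) +
        Real.log (∫ ω, Real.exp (-coordAvg (uniformSphere (volume : Measure E)) C (fun ω => ∑ n ∈ I, g n ω) ω)
          ∂Measure.pi (fun _ : Λ => uniformSphere (volume : Measure E))) := by
  set μ : Measure (Λ → sphere (0 : E) 1) := Measure.pi (fun _ : Λ => uniformSphere (volume : Measure E))
    with hμ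
  set V : (Λ → sphere (0 : E) 1) → ℝ := fun ω => ∑ n ∈ I, 2 * κ ^ 2 / ((Module.finrank ℝ E : ℝ) - 1) *
    ‖tangentKick (localField U n (fun i => ((ω i : sphere (0 : E) 1) : E))) (ω n : E)‖ ^ 2 with hV
  set ρ : ℝ := I.card * (4 * |κ| ^ 3 * υ ^ 3 / ((Module.finrank ℝ E : ℝ) - 1) ^ 2 * c ^ 3) with hρ
  have hVc : Continuous V := continuous_finsetSum _ fun n _ =>
    (continuous_loCarreSite (U := U) κ n).comp continuous_sphereConfig
  -- the chain `(c⁴/8)Σ_i Var_i − 4ρ² ≤ (c⁴/8)Var(A_C V) − 4ρ² ≤ Var(A_C h)`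
  have hB := sum_variance_condExp_le_variance_coordAvg Tp P hP C hPC hVc
  have hS := variance_coordAvg_static_le hU0 hUadj hd κ S₀ hυ he m hc0 hc hg I C (T := T)
  rw [← hμ] at hB hS
  set x : ℝ := max 0 (c ^ 4 / 8 * ∑ i ∈ Tp, ∫ ω, (coordAvg (uniformSphere (volume : Measure E))
      (Finset.univ \ P i) V ω - ∫ ω', V ω' ∂μ) ^ 2 ∂μ - 4 * ρ ^ 2) with hx
  have hx0 : 0 ≤ x := le_max_left _ _
  have hxle : x ≤ ∫ ω, (coordAvg (uniformSphere (volume : Measure E)) C (fun ω => ∑ n ∈ I, g n ω) ω -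
      ∫ ω', (∑ n ∈ I, g n ω') ∂μ) ^ 2 ∂μ := by
    refine max_le (integral_nonneg fun ω => sq_nonneg _) ?_
    have hc4 : 0 ≤ c ^ 4 / 8 := by positivity
    have h1 := mul_le_mul_of_nonneg_left hB hc4
    simp only [hV, hρ] at h1 hS ⊢
    linarith
  have hmain := log_one_add_div_le_blockTerm_of_le_variance hd κ S₀ hυ he m hc0 hg I C hx0 hxle (T := T)
  simpa [hx, hV, hρ, hμ] using hmain

/-- **THE EXTENSIVE FLOOR IN TERMS OF CONDITIONAL VARIANCES.**  In the setting of
`sum_blocks_sub_le_klDiv_map_loFlow` (blocks `B_j`, `j ∈ T`, pairwise disjoint and separated for the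
radius-`(m+1)` balls; corridors `C = Λ ∖ ⋃_j B_j`; `I_j = {n : ball(n) meets B_j}`; static block terms
`V_j = Σ_{n∈I_j} v_n`; `ρ_j = |I_j|(4|κ|³υ³/(d−1)²)c³`, `M_j = 2|I_j|(κ²υ²/(d−1))c²`), with, for each block,
a finite family `𝒫_j` of pairwise disjoint groups of sites off the corridors:
`Σ_{j∈T} log(1 + (max 0 ((c⁴/8)Σ_{P∈𝒫_j} Var(E[V_j | ω_P]) − 4ρ_j²))/(2 + M_j)) − |Λ|·(12κ²υ²/(d−1))·c²·τ_m(c)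
  ≤ KL((Φ_{0→c})_*π̄ ‖ e^{−cS}π̄/Z_c)`. -/
theorem sum_log_one_add_pairs_sub_le_klDiv_map_loFlow (hU0 : ∀ n, U n n = 0)
    (hUadj : ∀ m n (v w : E), ⟪U m n v, w⟫ = ⟪v, U n m w⟫) (hd : 2 ≤ Module.finrank ℝ E)
    (κ S₀ : ℝ) {υ : ℝ} (hυ : ∀ k, ∑ m, ‖U k m‖ ≤ υ) {c : ℝ} (hc0 : 0 ≤ c) (hc : c ≤ |T| + 1)
    {e : Λ → E} (he : ∀ n, ‖e n‖ = 1) (m : ℕ)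
    {g : Λ → (Λ → sphere (0 : E) 1) → ℝ}
    (hg : ∀ n ω, g n ω = -∫ u in (0 : ℝ)..c, u * (2 * κ ^ 2 / ((Module.finrank ℝ E : ℝ) - 1) *
      ‖tangentKick (localField U n (sphereTDFlow (G := fun _ : ℝ => loFlowAction κ S₀ U)
          (contDiff_const_family (contDiff_loFlowAction U κ S₀)) T 0 u
          ((nball (fun k => insert k (couplingNbhd U k)) (m + 1) n).piecewise
            (fun i => ((ω i : sphere (0 : E) 1) : E)) e)))
        (sphereTDFlow (G := fun _ : ℝ => loFlowAction κ S₀ U)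
          (contDiff_const_family (contDiff_loFlowAction U κ S₀)) T 0 u
          ((nball (fun k => insert k (couplingNbhd U k)) (m + 1) n).piecewise
            (fun i => ((ω i : sphere (0 : E) 1) : E)) e) n)‖ ^ 2))
    {J : Type*} (Tb : Finset J) (B : J → Finset Λ)
    (hB : ∀ j ∈ Tb, ∀ j' ∈ Tb, j ≠ j' → Disjoint (B j) (B j'))
    (hsep : ∀ n, ∀ j ∈ Tb, ∀ j' ∈ Tb,
      ¬ Disjoint (nball (fun k => insert k (couplingNbhd U k)) (m + 1) n) ↑(B j) →
      ¬ Disjoint (nball (fun k => insert k (couplingNbhd U k)) (m + 1) n) ↑(B j') → j = j')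
    (Pf : J → Finset (Finset Λ))
    (hP : ∀ j ∈ Tb, ∀ P ∈ Pf j, ∀ P' ∈ Pf j, P ≠ P' → Disjoint P P')
    (hPC : ∀ j ∈ Tb, ∀ P ∈ Pf j, Disjoint P (Finset.univ \ Tb.biUnion B)) :
    ∑ j ∈ Tb, Real.log (1 + (max 0 (c ^ 4 / 8 * ∑ P ∈ Pf j, ∫ ω,
          (coordAvg (uniformSphere (volume : Measure E)) (Finset.univ \ P)
            (fun ω => ∑ n ∈ Finset.univ.filter (fun n =>
              ¬ Disjoint (nball (fun k => insert k (couplingNbhd U k)) (m + 1) n) ↑(B j)),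
              2 * κ ^ 2 / ((Module.finrank ℝ E : ℝ) - 1) *
                ‖tangentKick (localField U n (fun i => ((ω i : sphere (0 : E) 1) : E))) (ω n : E)‖ ^ 2) ω -
          ∫ ω', (∑ n ∈ Finset.univ.filter (fun n =>
              ¬ Disjoint (nball (fun k => insert k (couplingNbhd U k)) (m + 1) n) ↑(B j)),
              2 * κ ^ 2 / ((Module.finrank ℝ E : ℝ) - 1) *
                ‖tangentKick (localField U n (fun i => ((ω' i : sphere (0 : E) 1) : E))) (ω' n : E)‖ ^ 2)
            ∂Measure.pi (fun _ : Λ => uniformSphere (volume : Measure E))) ^ 2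
          ∂Measure.pi (fun _ : Λ => uniformSphere (volume : Measure E)) -
        4 * ((Finset.univ.filter (fun n =>
            ¬ Disjoint (nball (fun k => insert k (couplingNbhd U k)) (m + 1) n) ↑(B j))).card *
          (4 * |κ| ^ 3 * υ ^ 3 / ((Module.finrank ℝ E : ℝ) - 1) ^ 2 * c ^ 3)) ^ 2)) /
        (2 + 2 * ((Finset.univ.filter (fun n =>
            ¬ Disjoint (nball (fun k => insert k (couplingNbhd U k)) (m + 1) n) ↑(B j))).card *
          (κ ^ 2 * υ ^ 2 / ((Module.finrank ℝ E : ℝ) - 1) * c ^ 2)))) -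
      Fintype.card Λ * (12 * κ ^ 2 * υ ^ 2 / ((Module.finrank ℝ E : ℝ) - 1) * c ^ 2 *
        (2 * Real.exp (3 * |κ| * υ / ((Module.finrank ℝ E : ℝ) - 1) * c) *
          (3 * |κ| * υ / ((Module.finrank ℝ E : ℝ) - 1) * c) ^ (m + 1) / ((m + 1)! : ℝ))) ≤
      (klDiv (Measure.map (sphereTDFlowMap (G := fun _ : ℝ => loFlowAction κ S₀ U)
          (contDiff_const_family (contDiff_loFlowAction U κ S₀)) T 0 c)
          (Measure.pi (fun _ : Λ => uniformSphere (volume : Measure E))))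
        ((Measure.pi (fun _ : Λ => uniformSphere (volume : Measure E))).tilted
          fun ω => -(c * esAction κ S₀ U (fun m => (ω m : E))))).toReal := by
  refine le_trans ?_
    (sum_blocks_sub_le_klDiv_map_loFlow hU0 hUadj hd κ S₀ hυ hc0 hc he m hg Tb B hB hsep (T := T))
  gcongr with j hj
  exact log_one_add_pairs_div_le_blockTerm hU0 hUadj hd κ S₀ hυ he m hc0 hc hg _ _ (Pf j) (fun P => P)
    (hP j hj) (hPC j hj) (T := T)

end Pairs

end Summit.Ventures.LatticeQCDFlow.Exactness

end
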